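import Literature.AlgebraicGeometry.HodgeTheory.MaxRationalSubHodgeStructureKunnethSymmetric
import Literature.AlgebraicGeometry.HodgeTheory.MaxRationalSubHodgeStructureSemisimple
import Literature.AlgebraicGeometry.HodgeTheory.HodgeIndexPrimitiveAlgebraicHolds
import HarnessLib

/-!
# The Néron–Severi pieces `Hⁱ(X) ⊗ NS(S)_ℂ` of `max(X × S, k, r)`: non-degeneracy of the intersection form on
# `NS(S)_ℂ`, Poincaré-dual divisor classes, and the engine over a sub-piece spanned by algebraic classes

Family `hodge`, layer `Literature/AlgebraicGeometry/HodgeTheory`; lane `lit-hodgefound` (Track 2 foundations,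
Layer A1/A4). THEOREMS ONLY (no definition, no named fact; D-0026). Sequel of
`MaxRationalSubHodgeStructureKunnethAlgebraicPieces` (the engine over a Künneth piece `Hⁱ(X) ⊗ H^{2b}(Y)` all of
whose classes are algebraic). Here the second factor of the piece is only a SUB-space `A ⊆ Nᵇ H^{2b}(Y)` spanned by
algebraic classes `ν_t` admitting ALGEBRAIC POINCARÉ-DUAL classes `ν'_u ∈ Nᵉ H^{2e}(Y)`, `⟨ν_t ∪ ν'_u, [Y]⟩ = δ_{tu}`
(`b + e = dim Y`); the model case is `Y = S` a surface, `b = e = 1`, `A = NS(S)_ℂ = algebraicClasses S 1`, where the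
dual classes exist by the HODGE INDEX THEOREM (non-degeneracy of the intersection form on `NS(S)_ℚ`, the tree's
`hodgeIndex_surface_holds` + Lefschetz `(1,1)` `lefschetzOneOne_rational_holds`).

Sources, VERBATIM. R. Hartshorne, *Algebraic Geometry* (GTM 52, 1977), V Thm. 1.9 (Hodge index theorem) and
V Rem. 1.9.1: «the intersection pairing induces a nondegenerate bilinear pairing `Num X × Num X → ℤ`»; App. A
Thm. 5.2. C. Voisin, *Hodge Theory and Complex Algebraic Geometry I* (CUP 2002), §6.3.2 Thm. 6.32 (Hodge index),
§11.3.3 Thm. 11.38 (Künneth) and p. 287 (11.11). A. Grothendieck, *Hodge's general conjecture is false for trivial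
reasons*, Topology 8 (1969) p. 300 («the largest sub-space of [`Fʳ Hᵏ ∩ Hᵏ(X, ℚ)`], generating a subspace of
`Hᵏ(X^an, ℂ)` which is a sub-Hodge structure»). D. Huybrechts, *Lectures on K3 surfaces* (CUP 2016), Ch. 3 §3.2–3.3
(«the transcendental lattice `T(X) := NS(X)^⊥`»; over `ℂ`-coefficients `H²(S, ℂ) = NS(S)_ℂ ⊕ T(S)_ℂ` as soon as the
intersection form on `NS(S)` is non-degenerate).

## What is proved

* §1 `exists_ratCast_eq_kroneckerPairing_fundamentalClass` (intersection numbers of rational classes are rational),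
  `cupPairing_comm_two` (the intersection form on `H²(S(ℂ); ℂ)` is symmetric), `isRefl_cupPairing_two`.
* §2 **`eq_zero_of_mem_algebraicClasses_of_forall_cupPairing_eq_zero`** — THE INTERSECTION FORM ON `NS(S)_ℂ` IS
  NON-DEGENERATE (Hodge index on the rational classes + a `ℚ`-basis of `NS(S)_ℚ` + `det ≠ 0` descends from `ℂ` to `ℚ`);
  `nondegenerate_restrict_cupPairing_algebraicClasses`, **`isCompl_algebraicClasses_orthogonal`** (`H²(S, ℂ) =
  NS(S)_ℂ ⊕ NS(S)_ℂ^⊥`), **`exists_dual_family_algebraicClasses_one`** (algebraic Poincaré-dual classes to a basis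
  of `NS(S)_ℂ`).
* §3 **`GeneralHodgePropertyFor.le_supportedClasses_of_le_map₂_cross_span_of_dual`** — THE ENGINE OVER A SUB-PIECE
  `Hⁱ(X) ⊠ A`, `A = span{ν_t} ⊆ Nᵇ H^{2b}(Y)` with algebraic dual classes: `GHC(X, i, c)` settles every admissible
  `W ⊆ Hⁱ(X) ⊠ A` of level `c + b` (coordinates `exists_eq_sum_cross_of_mem_map₂_cross_span`).
* §4 The Néron–Severi pieces: **`GeneralHodgePropertyFor.le_supportedClasses_of_le_map₂_cross_algebraicClasses_one`**
  (admissible `W ⊆ Hⁱ(X) ⊠ NS(S)_ℂ` of level `c + 1` are settled by `GHC(X, i, c)`, `S` any smooth projective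
  surface), **`maxRatSubHodgeInFilt_inf_map₂_cross_algebraicClasses_one_le_supportedClasses`** (the component of
  `max(X × S, i + 2, r)` in `Hⁱ(X) ⊠ NS(S)_ℂ` lies in `Nʳ` as soon as `GHC(X, i, r − 1)`; `…_of_forall`), after
  `HodgeModel.maxRatSubHodgeInFilt_inf_map₂_cross_supportedClasses_mem` (admissibility of `max ⊓ (Hⁱ(X) ⊠ Nᵇ H^{2b}(Y))`).

## References

* [Hartshorne1977] R. Hartshorne, Algebraic Geometry, GTM 52 (Springer 1977), V Thm. 1.9, V Rem. 1.9.1, App. A Thm. 5.2.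
* [VoisinHodgeI2002] C. Voisin, Hodge Theory and Complex Algebraic Geometry I (CUP 2002), §6.3.2 Thm. 6.32,
  §7.1.2, §11.3.3 Thm. 11.38 and p. 287.
* [GrothendieckTopology1969] A. Grothendieck, Hodge's general conjecture is false for trivial reasons, Topology 8
  (1969) 299–303, p. 300.
* [Huybrechts2016K3] D. Huybrechts, Lectures on K3 Surfaces (CUP 2016), Ch. 3 §3.2–§3.3.
* [HatcherAT2002] A. Hatcher, Algebraic Topology (CUP 2002), §3.1 p. 198 and §3.3 Prop. 3.38.
-/

noncomputable section

open CategoryTheory AlgebraicGeometry MonoidalCategory CartesianMonoidalCategory Finset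
open Literature.AlgebraicTopology.SingularHomology
open Literature.Geometry.Kaehler
open Literature.AlgebraicGeometry.Motives (IsSmoothProjective ComplexPoints)
open Literature.Barriers.HodgeConjecture (IsRatBasisOn ratComb smoothProjective_rationalClasses_finiteRatBasis_holds)

namespace Literature.AlgebraicGeometry.HodgeTheory

variable {n m : ℕ} {X Y : Motives.SchemeOver ℂ}

/-! ### §1 Rationality and symmetry of intersection numbers -/

/-- **Intersection numbers of rational classes are rational**: `⟨c, [Y]⟩ ∈ ℚ` for a rational class
`c ∈ H^{2m}(Y(ℂ); ℂ)` (`[Y]` is the complexification of the rational fundamental class,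
`fundamentalClass_complexOrientationFamily`, and the Kronecker pairing commutes with `ℚ → ℂ`).
[cite: HatcherAT2002, §3.1 p. 198] [cite: VoisinHodgeI2002, §7.1.2] -/
theorem exists_ratCast_eq_kroneckerPairing_fundamentalClass (hY : IsSmoothProjective m Y)
    {c : complexBetti Y (2 * m)} (hc : IsRationalClass c) :
    ∃ q : ℚ, (q : ℂ) = kroneckerPairing ℂ ℂ (ComplexPoints Y) (2 * m) c (complexOrientationFamily hY).fundamentalClass := by
  obtain ⟨x, rfl⟩ := hc.exists_ringChange_eq
  rw [fundamentalClass_complexOrientationFamily, kroneckerPairing_ringChange_coeffChange_rat]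
  exact ⟨_, (eq_ratCast (algebraMap ℚ ℂ) _).symm⟩

/-- **The intersection form on `H²(S(ℂ); ℂ)` is symmetric** (graded commutativity in even degrees).
[cite: HatcherAT2002, §3.2 Thm. 3.11] [cite: VoisinHodgeI2002, §7.1.2] -/
theorem cupPairing_comm_two {S : Motives.SchemeOver ℂ} (hS : IsSmoothProjective 2 S) (c d : complexBetti S (2 * 1)) :
    cupPairing (complexOrientationFamily hS) (show 2 * 1 + 2 * 1 = 2 * 2 by omega) c d =
      cupPairing (complexOrientationFamily hS) (show 2 * 1 + 2 * 1 = 2 * 2 by omega) d c := by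
  rw [cupPairing_apply, cupPairing_apply, cupProduct_gradedComm_holds ℂ (ComplexPoints S) _ _ c d,
    Even.neg_one_pow (by decide), one_smul]

/-- The intersection form on `H²(S(ℂ); ℂ)` is reflexive. [cite: HatcherAT2002, §3.2 Thm. 3.11] -/
theorem isRefl_cupPairing_two {S : Motives.SchemeOver ℂ} (hS : IsSmoothProjective 2 S) :
    LinearMap.IsRefl (cupPairing (complexOrientationFamily hS) (show 2 * 1 + 2 * 1 = 2 * 2 by omega)) :=
  fun c d h ↦ by rwa [cupPairing_comm_two hS]

/-! ### §2 Non-degeneracy of the intersection form on `NS(S)_ℂ` (Hodge index) -/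

/-- **Hodge index, Kronecker form**: a non-zero RATIONAL class of `NS(S)_ℂ = algebraicClasses S 1` has non-zero
intersection number with some class of `NS(S)_ℂ` (the tree's `exists_cup_ne_zero_of_hodgeIndex`, discharged by
`hodgeIndex_surface_holds` and `lefschetzOneOne_rational_holds`). [cite: Hartshorne1977, V Thm. 1.9 and V Rem. 1.9.1]
[cite: VoisinHodgeI2002, §6.3.2 Thm. 6.32] -/
theorem exists_cupPairing_ne_zero_of_isRationalClass_of_mem_algebraicClasses {S : Motives.SchemeOver ℂ}
    (hS : IsSmoothProjective 2 S) {c : complexBetti S (2 * 1)} (hcQ : IsRationalClass c)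
    (hcN : c ∈ algebraicClasses S 1) (hc0 : c ≠ 0) :
    ∃ d ∈ algebraicClasses S 1,
      cupPairing (complexOrientationFamily hS) (show 2 * 1 + 2 * 1 = 2 * 2 by omega) c d ≠ 0 := by
  obtain ⟨d, -, -, hdN, hne⟩ := exists_cup_ne_zero_of_hodgeIndex hodgeIndex_surface_holds
    lefschetzOneOne_rational_holds hS c hcQ (isOfHodgeType_of_mem_algebraicClasses_of_isSmoothProjective hS 1 hcN) hc0
  refine ⟨d, hdN, fun h ↦ hne ?_⟩
  rw [cupPairing_apply] at h
  exact eq_zero_of_kroneckerPairing_fundamentalClass_eq_zero hS h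

/-- **THE INTERSECTION FORM ON `NS(S)_ℂ` IS NON-DEGENERATE**: a class `d ∈ NS(S)_ℂ` orthogonal to all of `NS(S)_ℂ`
is zero. Proof: a `ℚ`-basis `b` of `NS(S)_ℚ` is a `ℂ`-basis of `NS(S)_ℂ` (`isRationallySpanned_supportedClasses`,
`linearIndependent_of_isRationalClass`); the Gram matrix `G = (⟨b_u ∪ b_t, [S]⟩)` is rational; if `d = Σ z_t b_t ≠ 0`
were orthogonal to `NS(S)_ℂ` then `det G = 0` over `ℂ`, hence over `ℚ`, giving a non-zero RATIONAL class orthogonal to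
`NS(S)_ℂ` — against the Hodge index theorem. [cite: Hartshorne1977, V Thm. 1.9 and V Rem. 1.9.1]
[cite: VoisinHodgeI2002, §6.3.2 Thm. 6.32] -/
theorem eq_zero_of_mem_algebraicClasses_of_forall_cupPairing_eq_zero {S : Motives.SchemeOver ℂ}
    (hS : IsSmoothProjective 2 S) {d : complexBetti S (2 * 1)} (hdN : d ∈ algebraicClasses S 1)
    (h : ∀ c ∈ algebraicClasses S 1,
      cupPairing (complexOrientationFamily hS) (show 2 * 1 + 2 * 1 = 2 * 2 by omega) c d = 0) :
    d = 0 := by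
  classical
  set B := cupPairing (complexOrientationFamily hS) (show 2 * 1 + 2 * 1 = 2 * 2 by omega) with hB
  -- a `ℚ`-basis of the rational classes of `NS(S)_ℂ`
  obtain ⟨r₀, b₀, hb₀⟩ := smoothProjective_rationalClasses_finiteRatBasis_holds 2 S hS (2 * 1)
  obtain ⟨ρ, b, hb⟩ : ∃ (ρ : ℕ) (b : Fin ρ → complexBetti S (2 * 1)),
      IsRatBasisOn {c : complexBetti S (2 * 1) | c ∈ algebraicClasses S 1 ∧ IsRationalClass c} b :=
    hb₀.exists_of_subset (fun _ hc ↦ hc.2) ⟨Submodule.zero_mem _, IsRationalClass.zero⟩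
      (fun _ hx _ hy ↦ ⟨Submodule.add_mem _ hx.1 hy.1, hx.2.add hy.2⟩)
      (fun a _ hx ↦ ⟨Submodule.smul_mem _ _ hx.1, hx.2.smul a⟩)
  have hNspan : algebraicClasses S 1 = Submodule.span ℂ (Set.range b) :=
    Eq.trans (isRationallySpanned_supportedClasses hS (2 * 1) 1) hb.span_eq
  -- the rational Gram matrix
  have hq : ∀ u t, ∃ q : ℚ, (q : ℂ) = B (b u) (b t) := fun u t ↦ by
    rw [hB, cupPairing_apply]
    exact exists_ratCast_eq_kroneckerPairing_fundamentalClass hS ((hb.mem u).2.cup _ (hb.mem t).2)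
  choose q hq using hq
  set G : Matrix (Fin ρ) (Fin ρ) ℚ := Matrix.of fun u t ↦ q u t with hG
  -- `B (b u) (Σ z_t b_t) = ((G.map cast) *ᵥ z) u`
  have hGz : ∀ (z : Fin ρ → ℂ) (u : Fin ρ),
      B (b u) (∑ t, z t • b t) = (G.map (fun x : ℚ ↦ (x : ℂ))).mulVec z u := by
    intro z u
    rw [map_sum]
    change _ = ∑ t, (G u t : ℂ) * z t
    refine Finset.sum_congr rfl fun t _ ↦ ?_
    rw [map_smul, smul_eq_mul, mul_comm, hG, Matrix.of_apply, hq]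
  -- the Gram matrix is non-singular: a rational kernel vector is a rational class orthogonal to `NS(S)_ℂ`
  have hdet : G.det ≠ 0 := by
    intro hdet
    obtain ⟨w, hw0, hw⟩ := Matrix.exists_mulVec_eq_zero_iff.2 hdet
    have hc' : ratComb b w ∈ {c : complexBetti S (2 * 1) | c ∈ algebraicClasses S 1 ∧ IsRationalClass c} := hb.1 w
    have hc'0 : ratComb b w ≠ 0 := fun h0 ↦ hw0 (hb.eq_zero h0)
    -- `B (b u) (ratComb b w) = ((G *ᵥ w) u : ℂ) = 0`
    have hu : ∀ u, B (b u) (ratComb b w) = 0 := by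
      intro u
      have h1 := hGz (fun t ↦ ((w t : ℚ) : ℂ)) u
      have h2 : (G.map (fun x : ℚ ↦ (x : ℂ))).mulVec (fun t ↦ ((w t : ℚ) : ℂ)) u = (((G.mulVec w) u : ℚ) : ℂ) := by
        rw [show (fun x : ℚ ↦ (x : ℂ)) = (Rat.castHom ℂ : ℚ → ℂ) from rfl,
          show (fun t ↦ ((w t : ℚ) : ℂ)) = (Rat.castHom ℂ : ℚ → ℂ) ∘ w from rfl, ← RingHom.map_mulVec]
        rfl
      rw [h2, hw, Pi.zero_apply, Rat.cast_zero] at h1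
      exact h1
    -- hence `B c (ratComb b w) = 0` for all `c ∈ NS(S)_ℂ`, and by symmetry `B (ratComb b w) c = 0`
    have hall : ∀ c ∈ algebraicClasses S 1, B (ratComb b w) c = 0 := by
      intro c hc
      rw [hB, cupPairing_comm_two hS, ← LinearMap.flip_apply]
      rw [hNspan] at hc
      refine (Submodule.span_le (p := LinearMap.ker (B.flip (ratComb b w)))).2 ?_ hc
      rintro _ ⟨u, rfl⟩
      exact hu u
    obtain ⟨dd, hddN, hne⟩ :=
      exists_cupPairing_ne_zero_of_isRationalClass_of_mem_algebraicClasses hS hc'.2 hc'.1 hc'0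
    exact hne (hall dd hddN)
  -- conclude: the coordinates of `d` solve `(G.map cast) *ᵥ z = 0`
  have hd : d ∈ Submodule.span ℂ (Set.range b) := hNspan ▸ hdN
  obtain ⟨z, rfl⟩ := (Submodule.mem_span_range_iff_exists_fun ℂ).1 hd
  have hz : (G.map (fun x : ℚ ↦ (x : ℂ))).mulVec z = 0 := by
    ext u
    rw [← hGz z u, Pi.zero_apply]
    exact h (b u) (hNspan ▸ Submodule.subset_span ⟨u, rfl⟩)
  by_contra hne
  have hz0 : z ≠ 0 := by
    rintro rfl
    exact hne (by simp)
  have hdetC : (G.map (fun x : ℚ ↦ (x : ℂ))).det = 0 := Matrix.exists_mulVec_eq_zero_iff.1 ⟨z, hz0, hz⟩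
  have hdetC' : ((G.det : ℚ) : ℂ) = 0 := by
    rw [show ((G.det : ℚ) : ℂ) = Rat.castHom ℂ G.det from rfl, RingHom.map_det]
    exact hdetC
  exact hdet (by exact_mod_cast hdetC')

/-- **The intersection form restricted to `NS(S)_ℂ` is non-degenerate.** [cite: Hartshorne1977, V Thm. 1.9 and V Rem. 1.9.1]
[cite: VoisinHodgeI2002, §6.3.2 Thm. 6.32] -/
theorem nondegenerate_restrict_cupPairing_algebraicClasses {S : Motives.SchemeOver ℂ} (hS : IsSmoothProjective 2 S) :
    (LinearMap.BilinForm.restrict (cupPairing (complexOrientationFamily hS) (show 2 * 1 + 2 * 1 = 2 * 2 by omega))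
      (algebraicClasses S 1)).Nondegenerate := by
  refine (LinearMap.IsRefl.nondegenerate_iff_separatingRight fun x y h ↦ ?_).2 fun y hy ↦ ?_
  · rw [LinearMap.BilinForm.restrict_apply, LinearMap.domRestrict_apply] at h ⊢
    rwa [cupPairing_comm_two hS]
  · refine Subtype.ext (eq_zero_of_mem_algebraicClasses_of_forall_cupPairing_eq_zero hS y.2 fun c hc ↦ ?_)
    have h := hy ⟨c, hc⟩
    rwa [LinearMap.BilinForm.restrict_apply, LinearMap.domRestrict_apply] at h

/-- **`H²(S(ℂ); ℂ) = NS(S)_ℂ ⊕ NS(S)_ℂ^⊥`** (the complexified transcendental part is a complement of the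
Néron–Severi part). [cite: Huybrechts2016K3, Ch. 3 §3.2–§3.3] [cite: Hartshorne1977, V Rem. 1.9.1] -/
theorem isCompl_algebraicClasses_orthogonal {S : Motives.SchemeOver ℂ} (hS : IsSmoothProjective 2 S) :
    IsCompl (algebraicClasses S 1)
      (LinearMap.BilinForm.orthogonal
        (cupPairing (complexOrientationFamily hS) (show 2 * 1 + 2 * 1 = 2 * 2 by omega)) (algebraicClasses S 1)) := by
  haveI := finite_complexBetti hS (2 * 1)
  exact LinearMap.BilinForm.isCompl_orthogonal_of_restrict_nondegenerate (isRefl_cupPairing_two hS)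
    (nondegenerate_restrict_cupPairing_algebraicClasses hS)

/-- **Algebraic Poincaré-dual classes to a basis of `NS(S)_ℂ`**: for a basis `(β_t)` of `NS(S)_ℂ` there are classes
`ν'_u ∈ NS(S)_ℂ` with `⟨β_t ∪ ν'_u, [S]⟩ = δ_{tu}`. [cite: Hartshorne1977, V Thm. 1.9 and V Rem. 1.9.1]
[cite: VoisinHodgeI2002, §6.3.2 Thm. 6.32 and p. 287 (11.11)] -/
theorem exists_dual_family_algebraicClasses_one {S : Motives.SchemeOver ℂ} (hS : IsSmoothProjective 2 S)
    {ι : Type} [DecidableEq ι] (β : Module.Basis ι ℂ ↥(algebraicClasses S 1)) :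
    ∃ ν' : ι → complexBetti S (2 * 1), (∀ u, ν' u ∈ algebraicClasses S 1) ∧ ∀ t u,
      kroneckerPairing ℂ ℂ (ComplexPoints S) (2 * 2)
        (cupProduct (show 2 * 1 + 2 * 1 = 2 * 2 by omega) (β t : complexBetti S (2 * 1)) (ν' u))
        (complexOrientationFamily hS).fundamentalClass = if t = u then 1 else 0 := by
  classical
  haveI := finite_complexBetti hS (2 * 1)
  set B := cupPairing (complexOrientationFamily hS) (show 2 * 1 + 2 * 1 = 2 * 2 by omega) with hB
  have hND := nondegenerate_restrict_cupPairing_algebraicClasses hS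
  refine ⟨fun u ↦ ((LinearMap.BilinForm.toDual (LinearMap.BilinForm.restrict B (algebraicClasses S 1)) hND).symm
      (β.coord u) : ↥(algebraicClasses S 1)), fun u ↦ Submodule.coe_mem _, fun t u ↦ ?_⟩
  rw [← cupPairing_apply, ← hB, cupPairing_comm_two hS, ← hB]
  have h := LinearMap.BilinForm.apply_toDual_symm_apply (hB := hND) (β.coord u) (β t)
  rw [LinearMap.BilinForm.restrict_apply, LinearMap.domRestrict_apply, Module.Basis.coord_apply, β.repr_self,
    Finsupp.single_apply] at h
  rw [h]

/-! ### §3 The engine over a sub-piece `Hⁱ(X) ⊠ A` spanned by algebraic classes with algebraic dual classes -/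

/-- **Coordinates in a sub-piece `Hⁱ(X) ⊠ span{ν_t}`**: every class of
`Submodule.map₂ (pr_X^* · ∪ pr_Y^* ·) ⊤ (span{ν_t})` is `Σ_t pr_X^* a_t ∪ pr_Y^* ν_t`.
[cite: VoisinHodgeI2002, §11.3.3 Thm. 11.38] -/
theorem exists_eq_sum_cross_of_mem_map₂_cross_span {i j k : ℕ} (hk : i + j = k) {ι : Type} [Fintype ι]
    (ν : ι → complexBetti Y j) {w : complexBetti (X ⊗ Y) k}
    (hw : w ∈ Submodule.map₂
      ((cupProduct hk).compl₁₂ (complexBetti.map (fst X Y) i).hom (complexBetti.map (snd X Y) j).hom)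
      ⊤ (Submodule.span ℂ (Set.range ν))) :
    ∃ a : ι → complexBetti X i,
      w = ∑ t, cupProduct hk (complexBetti.map (fst X Y) i (a t)) (complexBetti.map (snd X Y) j (ν t)) := by
  rw [map₂_cross_eq_span] at hw
  induction hw using Submodule.span_induction with
  | mem v hv =>
    obtain ⟨x, -, y, hy, rfl⟩ := hv
    obtain ⟨c, rfl⟩ := (Submodule.mem_span_range_iff_exists_fun ℂ).1 hy
    refine ⟨fun t ↦ c t • x, ?_⟩
    rw [map_sum, map_sum]
    refine Finset.sum_congr rfl fun t _ ↦ ?_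
    rw [map_smul, map_smul, map_smul, LinearMap.map_smul₂]
  | zero =>
    refine ⟨0, ?_⟩
    symm
    exact Finset.sum_eq_zero fun t _ ↦ by rw [Pi.zero_apply, map_zero, LinearMap.map_zero₂]
  | add v w _ _ hv hw =>
    obtain ⟨a, rfl⟩ := hv
    obtain ⟨a', rfl⟩ := hw
    refine ⟨a + a', ?_⟩
    rw [← Finset.sum_add_distrib]
    refine Finset.sum_congr rfl fun t _ ↦ ?_
    rw [Pi.add_apply, map_add, LinearMap.map_add₂]
  | smul c v _ hv =>
    obtain ⟨a, rfl⟩ := hv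
    refine ⟨c • a, ?_⟩
    rw [Finset.smul_sum]
    refine Finset.sum_congr rfl fun t _ ↦ ?_
    rw [Pi.smul_apply, map_smul, LinearMap.map_smul₂]

/-- **THE ENGINE OVER A SUB-PIECE — `GHC(X, i, c)` settles every admissible subspace of level `c + b` inside
`Hⁱ(X) ⊠ A`, `A = span{ν_t} ⊆ Nᵇ H^{2b}(Y)`, when the `ν_t` have algebraic Poincaré-dual classes `ν'_u ∈ Nᵉ H^{2e}(Y)`,
`⟨ν_t ∪ ν'_u, [Y]⟩ = δ_{tu}`, `b + e = m`**: every `W ∈ C.ratSubHodgeInFilt k (c + b)`, `W ⊆ Hⁱ(X) ⊠ A` (`i + 2b = k`)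
lies in `N^{c+b} Hᵏ((X ⊗ Y)(ℂ); ℂ)`. Proof: for `w = Σ_t pr_X^* a_t ∪ pr_Y^* ν_t ∈ W`,
`Ψ_u(w) := pr_{X*}(w ∪ pr_Y^* ν'_u) = λ a_u` (`complexGysin_fst_cross_cup_map_snd`, `λ ≠ 0` the fibre-integral
scalar); `Ψ_ρ(W)` is admissible of level `c + m` for each rational `(e, e)` class `ρ` (transport of admissibility), so
`pr_{X*}` lands it in `max(X, i, c) ⊆ Nᶜ` by `GHC(X, i, c)`; `ν'_u` is a combination of such `ρ`
(`algebraicClasses_le_span_hodgeClasses`), so `a_u ∈ Nᶜ` and `w ∈ Nᶜ ⊠ Nᵇ ⊆ N^{c+b}`.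
[cite: GrothendieckTopology1969, p. 300] [cite: VoisinHodgeI2002, §11.3.3 Thm. 11.38 and p. 287 (11.11)]
[cite: HatcherAT2002, §3.3 Prop. 3.38] -/
theorem GeneralHodgePropertyFor.le_supportedClasses_of_le_map₂_cross_span_of_dual (hX : IsSmoothProjective n X)
    (hY : IsSmoothProjective m Y) (C : HodgeModel (n + m) (X ⊗ Y)) {i b e k c : ℕ} (hbe : b + e = m)
    (hk : i + 2 * b = k) {ι : Type} [Fintype ι] [DecidableEq ι] {ν : ι → complexBetti Y (2 * b)}
    {ν' : ι → complexBetti Y (2 * e)} (hν : ∀ t, ν t ∈ supportedClasses Y (2 * b) b)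
    (hν' : ∀ u, ν' u ∈ supportedClasses Y (2 * e) e)
    (hdual : ∀ t u, kroneckerPairing ℂ ℂ (ComplexPoints Y) (2 * m)
      (cupProduct (show 2 * b + 2 * e = 2 * m by omega) (ν t) (ν' u)) (complexOrientationFamily hY).fundamentalClass =
        if t = u then 1 else 0)
    (hG : GeneralHodgePropertyFor n X i c) {W : Submodule ℂ (complexBetti (X ⊗ Y) k)}
    (hW : W ∈ C.ratSubHodgeInFilt k (c + b))
    (hWle : W ≤ Submodule.map₂
      ((cupProduct hk).compl₁₂ (complexBetti.map (fst X Y) i).hom (complexBetti.map (snd X Y) (2 * b)).hom)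
      ⊤ (Submodule.span ℂ (Set.range ν))) :
    W ≤ supportedClasses (X ⊗ Y) k (c + b) := by
  classical
  have hXY := hX.tensor_holds hY
  obtain ⟨A⟩ := hG.1
  have hab : (k + 2 * e) + 2 * n = i + 2 * (n + m) := by omega
  -- the fibre integral through the Kronecker pairing
  obtain ⟨lam, hlam0, hlam⟩ := exists_complexGysin_fst_map_snd_eq_kroneckerPairing_smul hX hY
  -- `Ψ_u (Φ_t a) = δ_{tu} λ • a`
  have key : ∀ (t u) (a : complexBetti X i),
      complexGysin complexOrientationFamily hXY hX (fst X Y) hab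
        (cupProduct (rfl : k + 2 * e = k + 2 * e)
          (cupProduct hk (complexBetti.map (fst X Y) i a) (complexBetti.map (snd X Y) (2 * b) (ν t)))
          (complexBetti.map (snd X Y) (2 * e) (ν' u))) = (if t = u then lam else 0) • a := by
    intro t u a
    rw [complexGysin_fst_cross_cup_map_snd complexOrientationFamily hX hY hbe hk a (ν t) (ν' u), hlam, hdual t u,
      map_smul, cupProduct_one]
    by_cases htu : t = u
    · rw [if_pos htu, if_pos htu, one_mul]
    · rw [if_neg htu, if_neg htu, zero_mul]
  -- `Ψ_ρ(W) ⊆ Nᶜ` for `ρ` rational of type `(e, e)`, then for every `ν''` in their span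
  have hΨρ : ∀ ρ : complexBetti Y (2 * e), IsRationalClass ρ → IsOfHodgeType m Y (2 * e) e e ρ →
      (W.map ((cupProduct (rfl : k + 2 * e = k + 2 * e)).flip (complexBetti.map (snd X Y) (2 * e) ρ))).map
          (complexGysin complexOrientationFamily hXY hX (fst X Y) hab) ≤ supportedClasses X i c := by
    intro ρ hρQ hρT
    have h1 : W.map ((cupProduct (rfl : k + 2 * e = k + 2 * e)).flip (complexBetti.map (snd X Y) (2 * e) ρ)) ∈
        C.ratSubHodgeInFilt (k + 2 * e) (c + m) := by
      have h := C.map_cupProduct_map_snd_mem_ratSubHodgeInFilt hX hY (rfl : k + 2 * e = k + 2 * e) hρQ hρT hW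
      rwa [show c + b + e = c + m by omega] at h
    have hV := C.complexGysin_map_mem_ratSubHodgeInFilt A hXY hX (fst X Y) (r := m) rfl hab h1
    exact (A.le_maxRatSubHodgeInFilt hV).trans ((generalHodgePropertyFor_iff_of_hodgeModel A hX i c).1 hG)
  have hΨspan : ∀ w ∈ W, ∀ ν'' ∈ Submodule.span ℂ
      {ρ : complexBetti Y (2 * e) | IsRationalClass ρ ∧ IsOfHodgeType m Y (2 * e) e e ρ},
      complexGysin complexOrientationFamily hXY hX (fst X Y) hab
        (cupProduct (rfl : k + 2 * e = k + 2 * e) w (complexBetti.map (snd X Y) (2 * e) ν'')) ∈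
          supportedClasses X i c := by
    intro w hw ν'' hν''
    induction hν'' using Submodule.span_induction with
    | mem ρ hρ => exact hΨρ ρ hρ.1 hρ.2 ⟨_, ⟨w, hw, rfl⟩, rfl⟩
    | zero =>
      rw [map_zero, map_zero, map_zero]
      exact Submodule.zero_mem _
    | add x y _ _ hx hy =>
      rw [map_add, map_add, map_add]
      exact Submodule.add_mem _ hx hy
    | smul t x _ hx =>
      rw [map_smul, map_smul, map_smul]
      exact Submodule.smul_mem _ t hx
  have hν'span : ∀ u, ν' u ∈ Submodule.span ℂ
      {ρ : complexBetti Y (2 * e) | IsRationalClass ρ ∧ IsOfHodgeType m Y (2 * e) e e ρ} := fun u ↦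
    algebraicClasses_le_span_hodgeClasses hY e (hν' u)
  -- conclude
  intro w hw
  obtain ⟨a, hwa⟩ := exists_eq_sum_cross_of_mem_map₂_cross_span hk ν (hWle hw)
  have hau : ∀ u, complexGysin complexOrientationFamily hXY hX (fst X Y) hab
      (cupProduct (rfl : k + 2 * e = k + 2 * e) w (complexBetti.map (snd X Y) (2 * e) (ν' u))) = lam • a u := by
    intro u
    rw [hwa, map_sum, LinearMap.sum_apply, map_sum]
    rw [Finset.sum_congr rfl fun t _ ↦ key t u (a t)]
    rw [Finset.sum_eq_single u (fun t _ htu ↦ by rw [if_neg htu, zero_smul])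
      (fun h ↦ absurd (Finset.mem_univ u) h), if_pos rfl]
  have haN : ∀ u, a u ∈ supportedClasses X i c := by
    intro u
    have h := hΨspan w hw (ν' u) (hν'span u)
    rw [hau u] at h
    have h' := Submodule.smul_mem _ lam⁻¹ h
    rwa [inv_smul_smul₀ hlam0] at h'
  rw [hwa]
  exact Submodule.sum_mem _ fun t _ ↦ cupProduct_map_fst_map_snd_mem_supportedClasses hX hY hk (haN t) (hν t)

/-- **The sub-piece `Hⁱ(X) ⊠ A` is admissible of level `b`** when `A ⊆ H^{2b}(Y)` is admissible of level `b` (e.g.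
`A = Nᵇ H^{2b}(Y)`, `HodgeModel.supportedClasses_mem_ratSubHodgeInFilt`); hence so is its intersection with
`max(X × Y, k, r)`, of level `r` for `b ≤ r`. [cite: VoisinHodgeI2002, §11.3.3 Thm. 11.40]
[cite: GrothendieckTopology1969, p. 300] -/
theorem HodgeModel.maxRatSubHodgeInFilt_inf_map₂_cross_supportedClasses_mem (hX : IsSmoothProjective n X)
    (hY : IsSmoothProjective m Y) (C : HodgeModel (n + m) (X ⊗ Y)) {i b k : ℕ} (hk : i + 2 * b = k) (r : ℕ) :
    C.maxRatSubHodgeInFilt k r ⊓ Submodule.map₂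
      ((cupProduct hk).compl₁₂ (complexBetti.map (fst X Y) i).hom (complexBetti.map (snd X Y) (2 * b)).hom)
      ⊤ (supportedClasses Y (2 * b) b) ∈ C.ratSubHodgeInFilt k r := by
  obtain ⟨A⟩ := nonempty_hodgeModel_holds hX
  obtain ⟨B⟩ := nonempty_hodgeModel_holds hY
  have h := HodgeModel.map₂_cross_mem_ratSubHodgeInFilt hX hY A B C hk (A.top_mem_ratSubHodgeInFilt_zero hX i)
    (B.supportedClasses_mem_ratSubHodgeInFilt hY (2 * b) b)
  exact C.inf_mem_ratSubHodgeInFilt (hX.tensor_holds hY) (C.maxRatSubHodgeInFilt_mem k r) h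

/-! ### §4 The Néron–Severi pieces `Hⁱ(X) ⊠ NS(S)_ℂ` -/

/-- `NS(S)_ℂ` is the span of (the coercion of) any of its bases. [cite: Hartshorne1977, V Rem. 1.9.1] -/
theorem span_range_basis_algebraicClasses_eq {S : Motives.SchemeOver ℂ} {p : ℕ} {ι : Type}
    (β : Module.Basis ι ℂ ↥(algebraicClasses S p)) :
    Submodule.span ℂ (Set.range fun t ↦ (β t : complexBetti S (2 * p))) = algebraicClasses S p := by
  rw [show (fun t ↦ (β t : complexBetti S (2 * p))) = (algebraicClasses S p).subtype ∘ β from rfl, Set.range_comp,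
    ← Submodule.map_span, β.span_eq, Submodule.map_top, Submodule.range_subtype]

/-- **THE NÉRON–SEVERI ENGINE — `GHC(X, i, c)` settles every admissible subspace of level `c + 1` inside
`Hⁱ(X) ⊠ NS(S)_ℂ`, for EVERY smooth projective surface `S`** (the Poincaré-dual classes inside `NS(S)_ℂ` exist by the
Hodge index theorem, §2). For `p_g(S) = 0` (`NS(S)_ℂ = H²(S)`) this is the prequel's engine; for a K3 or abelian
surface it settles the Néron–Severi part of the piece `Hⁱ(X) ⊗ H²(S)`, the transcendental part `Hⁱ(X) ⊗ T(S)_ℂ` being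
the genuinely open one. [cite: GrothendieckTopology1969, p. 300] [cite: Hartshorne1977, V Thm. 1.9 and V Rem. 1.9.1]
[cite: VoisinHodgeI2002, §6.3.2 Thm. 6.32, §11.3.3 Thm. 11.38 and p. 287 (11.11)] -/
theorem GeneralHodgePropertyFor.le_supportedClasses_of_le_map₂_cross_algebraicClasses_one {S : Motives.SchemeOver ℂ}
    (hX : IsSmoothProjective n X) (hS : IsSmoothProjective 2 S) (C : HodgeModel (n + 2) (X ⊗ S)) {i k c : ℕ}
    (hk : i + 2 * 1 = k) (hG : GeneralHodgePropertyFor n X i c) {W : Submodule ℂ (complexBetti (X ⊗ S) k)}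
    (hW : W ∈ C.ratSubHodgeInFilt k (c + 1))
    (hWle : W ≤ Submodule.map₂
      ((cupProduct hk).compl₁₂ (complexBetti.map (fst X S) i).hom (complexBetti.map (snd X S) (2 * 1)).hom)
      ⊤ (algebraicClasses S 1)) :
    W ≤ supportedClasses (X ⊗ S) k (c + 1) := by
  classical
  haveI := finite_complexBetti hS (2 * 1)
  set β := Module.finBasis ℂ ↥(algebraicClasses S 1) with hβ
  obtain ⟨ν', hν'N, hdual⟩ := exists_dual_family_algebraicClasses_one hS β
  refine hG.le_supportedClasses_of_le_map₂_cross_span_of_dual hX hS C (rfl : 1 + 1 = 2) hk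
    (ν := fun t ↦ (β t : complexBetti S (2 * 1))) (fun t ↦ (β t).2) hν'N hdual hW ?_
  rwa [span_range_basis_algebraicClasses_eq β]

/-- **The Néron–Severi component of `max`**: the component of `max(X × S, i + 2, r)` inside `Hⁱ(X) ⊠ NS(S)_ℂ` lies
in `Nʳ` as soon as `GHC(X, i, r − 1)` holds (for `r = 0` there is nothing to prove). [cite: GrothendieckTopology1969, p. 300]
[cite: Hartshorne1977, V Thm. 1.9 and V Rem. 1.9.1] [cite: VoisinHodgeI2002, §11.3.3 Thm. 11.38 and p. 287] -/
theorem maxRatSubHodgeInFilt_inf_map₂_cross_algebraicClasses_one_le_supportedClasses {S : Motives.SchemeOver ℂ}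
    (hX : IsSmoothProjective n X) (hS : IsSmoothProjective 2 S) (C : HodgeModel (n + 2) (X ⊗ S)) {i k r : ℕ}
    (hk : i + 2 * 1 = k) (hG : 1 ≤ r → GeneralHodgePropertyFor n X i (r - 1)) :
    C.maxRatSubHodgeInFilt k r ⊓ Submodule.map₂
      ((cupProduct hk).compl₁₂ (complexBetti.map (fst X S) i).hom (complexBetti.map (snd X S) (2 * 1)).hom)
      ⊤ (algebraicClasses S 1) ≤ supportedClasses (X ⊗ S) k r := by
  rcases Nat.eq_zero_or_pos r with rfl | hr
  · rw [supportedClasses_zero]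
    exact le_top
  · obtain ⟨c, rfl⟩ : ∃ c, r = c + 1 := ⟨r - 1, by omega⟩
    have hG' : GeneralHodgePropertyFor n X i c := by
      have h := hG hr
      rwa [Nat.add_sub_cancel] at h
    exact hG'.le_supportedClasses_of_le_map₂_cross_algebraicClasses_one hX hS C hk
      (C.maxRatSubHodgeInFilt_inf_map₂_cross_supportedClasses_mem hX hS hk (c + 1)) inf_le_right

/-- **All admissible subspaces of `X × S` inside `Hⁱ(X) ⊠ NS(S)_ℂ` are supported in codimension `r` when
`GHC(X, i, r')` holds for all `r'`** (e.g. `X` a curve, a surface, a threefold outside `(3, 1)`, a variety with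
algebraic cohomology): the Néron–Severi pieces of `X × S` never obstruct `GHC(X × S, k, r)`.
[cite: GrothendieckTopology1969, p. 300] [cite: Hartshorne1977, V Thm. 1.9 and V Rem. 1.9.1] -/
theorem maxRatSubHodgeInFilt_inf_map₂_cross_algebraicClasses_one_le_supportedClasses_of_forall
    {S : Motives.SchemeOver ℂ} (hX : IsSmoothProjective n X) (hS : IsSmoothProjective 2 S)
    (C : HodgeModel (n + 2) (X ⊗ S)) {i k : ℕ} (hk : i + 2 * 1 = k) (hG : ∀ r, GeneralHodgePropertyFor n X i r)
    (r : ℕ) :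
    C.maxRatSubHodgeInFilt k r ⊓ Submodule.map₂
      ((cupProduct hk).compl₁₂ (complexBetti.map (fst X S) i).hom (complexBetti.map (snd X S) (2 * 1)).hom)
      ⊤ (algebraicClasses S 1) ≤ supportedClasses (X ⊗ S) k r :=
  maxRatSubHodgeInFilt_inf_map₂_cross_algebraicClasses_one_le_supportedClasses hX hS C hk fun _ ↦ hG _

end Literature.AlgebraicGeometry.HodgeTheory

end
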